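import Summits.RiemannHypothesis.RiemannHypothesis.Theorems.LiTailContourCoWeight
import HarnessLib

/-!
# RiemannHypothesis / LiTailLaguerre — crux K2′ `LiPrimeTailLaguerre`, part 1: the NON-RELEASED prime powers on
# `Re w = 3/2` are `O(m^{−3/2})` uniformly in the upper limit (RH-FREE)

RH-FREE [rh-li-prover g5].  Route `Theses/LiTailLaguerre.lean` (round 7 of the LI column, rung leaf «Li TAIL–LAGUERRE LAW»
`LiTheory.LiZeroTailLaguerre`, PROOF-OF-DATA, NOT height-buying), item `LiPrimeTailLaguerre`
(stmt-RiemannHypothesis-19702, DECIDING).  The prime piece of the right edge of the half-strip is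
`liPrimeTail n T = (1/π) Re Σ_m Λ(m) ∫_T^∞ m^{−w} (2 − k_n(w)) dy` (`w = 3/2 + iy`, `2 − k_n = (1 − zⁿ)(1 − z⁻ⁿ)`,
`z = 1 − 1/w`).  THIS FILE: for a prime power `m` that is NOT released at the cut (`log m − n/T² ≥ g > 0`), each of the
three pieces `2 m^{−w}`, `m^{−w} zⁿ`, `m^{−w} z⁻ⁿ` has a non-stationary phase on `[T, Y]` (`|phase'| ≥ log m`, `log m`,
`g`), so by one integration by parts against the logarithmic derivative (the tree's first-derivative test
`PrimeEdge.norm_integral_le_of_logDeriv`, here with the derivative bound INTEGRATED so that `Y → ∞` is allowed)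
`‖∫_T^Y m^{−w}(2 − k_n(w)) dy‖ ≤ m^{−3/2} · B(log m, g, n/T²)` uniformly in `Y ≥ T`, hence the same bound for
`∫_{Ioi T}`.  Also: `‖z⁻ⁿ‖ ≤ e^{n/y²}` on the right edge (the weight bound for cuts `T = c√n` with `c < 1`).
Nothing here bears on the truth of RH.
-/

noncomputable section

-- D-0017: `Summit.<S>.<S>.…` is the designed namespace of a single-problem summit.
set_option linter.dupNamespace false

open Complex MeasureTheory intervalIntegral Set Filter
open scoped Real Interval Topology ArithmeticFunction.vonMangoldt

namespace Summit.RiemannHypothesis.RiemannHypothesis.Theorems.LiTheory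

open Literature.NumberTheory.LFunctions

namespace PrimeTail

open PrimeEdge TailContour

/-! ### One integration by parts, with the derivative bound integrated -/

/-- **First-derivative test, complex form, integrated remainder.**  If `E' = Eθ` on `[a, b]` with `θ` differentiable,
`θ'` continuous, `‖θ‖ ≥ D > 0`, `‖E‖ ≤ M`, `‖θ'‖ ≤ B` (a continuous function), then
`‖∫_a^b E‖ ≤ 2M/D + (M/D²) ∫_a^b B` (`∫ E = [E/θ] + ∫ E θ'/θ²`). [Titchmarsh 1986, Lemma 4.3, logarithmic-derivative form] -/
theorem norm_integral_le_of_logDeriv_integral {E θ θ' : ℝ → ℂ} {B : ℝ → ℝ} {a b D M : ℝ} (hab : a ≤ b)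
    (hD : 0 < D) (hM : 0 ≤ M)
    (hE : ∀ y ∈ Icc a b, HasDerivAt E (E y * θ y) y) (hθ : ∀ y ∈ Icc a b, HasDerivAt θ (θ' y) y)
    (hθ'c : ContinuousOn θ' (Icc a b)) (hBc : ContinuousOn B (Icc a b))
    (hDb : ∀ y ∈ Icc a b, D ≤ ‖θ y‖) (hMb : ∀ y ∈ Icc a b, ‖E y‖ ≤ M) (hBb : ∀ y ∈ Icc a b, ‖θ' y‖ ≤ B y) :
    ‖∫ y in a..b, E y‖ ≤ 2 * M / D + M / D ^ 2 * ∫ y in a..b, B y := by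
  have hθ0 : ∀ y ∈ Icc a b, θ y ≠ 0 := fun y hy h ↦ by
    have := hDb y hy; rw [h, norm_zero] at this; linarith
  have hEc : ContinuousOn E (Icc a b) := fun y hy ↦ (hE y hy).continuousAt.continuousWithinAt
  have hθc : ContinuousOn θ (Icc a b) := fun y hy ↦ (hθ y hy).continuousAt.continuousWithinAt
  have hF : ∀ y ∈ Icc a b, HasDerivAt (fun y ↦ E y / θ y) (E y - E y * θ' y / θ y ^ 2) y := by
    intro y hy
    refine ((hE y hy).div (hθ y hy) (hθ0 y hy)).congr_deriv ?_
    have := hθ0 y hy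
    field_simp
  have hGc : ContinuousOn (fun y ↦ E y * θ' y / θ y ^ 2) (Icc a b) :=
    (hEc.mul hθ'c).div (hθc.pow 2) fun y hy ↦ pow_ne_zero _ (hθ0 y hy)
  have hIcc : uIcc a b = Icc a b := uIcc_of_le hab
  have hiG : IntervalIntegrable (fun y ↦ E y * θ' y / θ y ^ 2) volume a b :=
    (hGc.mono hIcc.le).intervalIntegrable
  have hiF' : IntervalIntegrable (fun y ↦ E y - E y * θ' y / θ y ^ 2) volume a b :=
    ((hEc.mono hIcc.le).intervalIntegrable).sub hiG
  have hFTC : ∫ y in a..b, (E y - E y * θ' y / θ y ^ 2) = E b / θ b - E a / θ a :=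
    integral_eq_sub_of_hasDerivAt (fun y hy ↦ hF y (hIcc ▸ hy)) hiF'
  have hsplit : (∫ y in a..b, E y) = (E b / θ b - E a / θ a) + ∫ y in a..b, E y * θ' y / θ y ^ 2 := by
    rw [← hFTC, ← intervalIntegral.integral_add hiF' hiG]
    refine intervalIntegral.integral_congr fun y _ ↦ ?_
    simp only [sub_add_cancel]
  have hbd : ∀ y ∈ Icc a b, ‖E y / θ y‖ ≤ M / D := fun y hy ↦ by
    rw [norm_div]
    exact div_le_div₀ hM (hMb y hy) hD (hDb y hy)
  -- the integral term, bounded by `(M/D²) ∫ B`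
  have hpt : ∀ y ∈ Icc a b, ‖E y * θ' y / θ y ^ 2‖ ≤ M / D ^ 2 * B y := fun y hy ↦ by
    rw [norm_div, norm_mul, norm_pow]
    have hθD : D ^ 2 ≤ ‖θ y‖ ^ 2 := pow_le_pow_left₀ hD.le (hDb y hy) 2
    have hB0 : 0 ≤ B y := (norm_nonneg _).trans (hBb y hy)
    calc ‖E y‖ * ‖θ' y‖ / ‖θ y‖ ^ 2 ≤ M * B y / D ^ 2 :=
          div_le_div₀ (mul_nonneg hM hB0) (mul_le_mul (hMb y hy) (hBb y hy) (norm_nonneg _) hM) (pow_pos hD 2) hθD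
      _ = M / D ^ 2 * B y := by ring
  have hint : ‖∫ y in a..b, E y * θ' y / θ y ^ 2‖ ≤ ∫ y in a..b, M / D ^ 2 * B y := by
    refine (intervalIntegral.norm_integral_le_integral_norm hab).trans ?_
    refine intervalIntegral.integral_mono_on hab ?_ ?_ fun y hy ↦ hpt y hy
    · exact (hGc.norm.mono hIcc.le).intervalIntegrable
    · exact ((continuousOn_const.mul hBc).mono hIcc.le).intervalIntegrable
  rw [intervalIntegral.integral_const_mul] at hint
  calc ‖∫ y in a..b, E y‖ = ‖(E b / θ b - E a / θ a) + ∫ y in a..b, E y * θ' y / θ y ^ 2‖ := by rw [hsplit]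
    _ ≤ ‖E b / θ b‖ + ‖E a / θ a‖ + ‖∫ y in a..b, E y * θ' y / θ y ^ 2‖ :=
        (norm_add_le _ _).trans (add_le_add (norm_sub_le _ _) le_rfl)
    _ ≤ M / D + M / D + M / D ^ 2 * ∫ y in a..b, B y :=
        add_le_add (add_le_add (hbd b (right_mem_Icc.2 hab)) (hbd a (left_mem_Icc.2 hab))) hint
    _ = 2 * M / D + M / D ^ 2 * ∫ y in a..b, B y := by ring

/-- `∫_a^b 3n/y³ dy ≤ 3n/(2a²)` (`0 < a ≤ b`). -/
theorem integral_three_div_cube_le (n : ℕ) {a b : ℝ} (ha : 0 < a) (hab : a ≤ b) :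
    ∫ y in a..b, 3 * (n : ℝ) / y ^ 3 ≤ 3 * n / (2 * a ^ 2) := by
  -- antiderivative: `d/dy (−3n/(2y²)) = 3n/y³`
  have hderiv : ∀ y ∈ uIcc a b, HasDerivAt (fun y : ℝ ↦ -(3 * (n : ℝ)) / (2 * y ^ 2)) (3 * (n : ℝ) / y ^ 3) y := by
    intro y hy
    rw [uIcc_of_le hab] at hy
    have hy0 : y ≠ 0 := (ha.trans_le hy.1).ne'
    have h1 : HasDerivAt (fun y : ℝ ↦ 2 * y ^ 2) (2 * ((2 : ℕ) * y ^ (2 - 1))) y :=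
      (hasDerivAt_pow 2 y).const_mul 2
    have h2 := (hasDerivAt_const y (-(3 * (n : ℝ)))).div h1 (by positivity)
    refine h2.congr_deriv ?_
    field_simp
    ring
  have hcont : ContinuousOn (fun y : ℝ ↦ 3 * (n : ℝ) / y ^ 3) (uIcc a b) := by
    refine ContinuousOn.div continuousOn_const (continuousOn_id.pow 3) fun y hy ↦ ?_
    rw [uIcc_of_le hab] at hy
    exact pow_ne_zero _ (ha.trans_le hy.1).ne'
  rw [integral_eq_sub_of_hasDerivAt hderiv (hcont.intervalIntegrable)]
  have hb : 0 ≤ 3 * (n : ℝ) / (2 * b ^ 2) := by positivity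
  have e : -(3 * (n : ℝ)) / (2 * b ^ 2) - -(3 * (n : ℝ)) / (2 * a ^ 2) = 3 * n / (2 * a ^ 2) - 3 * n / (2 * b ^ 2) := by
    ring
  rw [e]
  linarith

/-! ### The weight `z⁻ⁿ` beyond any cut -/

/-- `‖z⁻ⁿ‖ ≤ e^{n/y²}` on the right edge (`y ≠ 0`): `‖z⁻¹‖² = 1 + 2/(y² + 1/4) ≤ e^{2/y²}`. -/
theorem norm_zq_pow_inv_le_exp (n : ℕ) {y : ℝ} (hy : y ≠ 0) : ‖(zq y ^ n)⁻¹‖ ≤ Real.exp (n / y ^ 2) := by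
  have hy2 : 0 < y ^ 2 := by positivity
  have hsq := norm_zq_inv_sq y
  have h1 : ‖(zq y)⁻¹‖ ^ 2 ≤ Real.exp (2 / y ^ 2) := by
    rw [hsq]
    have hle : 2 / (y ^ 2 + 1 / 4) ≤ 2 / y ^ 2 := div_le_div_of_nonneg_left (by norm_num) hy2 (by linarith)
    calc 1 + 2 / (y ^ 2 + 1 / 4) ≤ 2 / y ^ 2 + 1 := by linarith
      _ ≤ Real.exp (2 / y ^ 2) := Real.add_one_le_exp _
  have h2 : (‖(zq y ^ n)⁻¹‖) ^ 2 ≤ Real.exp (n / y ^ 2) ^ 2 := by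
    have eL : ‖(zq y ^ n)⁻¹‖ ^ 2 = (‖(zq y)⁻¹‖ ^ 2) ^ n := by
      rw [← inv_pow, norm_pow, ← pow_mul, mul_comm, pow_mul]
    have eR : Real.exp (n / y ^ 2) ^ 2 = Real.exp (2 / y ^ 2) ^ n := by
      rw [← Real.exp_nat_mul, ← Real.exp_nat_mul]; congr 1; push_cast; ring
    rw [eL, eR]
    exact pow_le_pow_left₀ (sq_nonneg _) h1 n
  exact (pow_le_pow_iff_left₀ (norm_nonneg _) (Real.exp_pos _).le two_ne_zero).1 h2

/-! ### The three non-released pieces on `[T, Y]` -/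

/-- The constant piece: `‖∫_T^Y 2 m^{−w} dy‖ ≤ 4 m^{−3/2}/log m` (`m ≥ 2`). -/
theorem norm_integral_two_le {m : ℕ} (hm : 2 ≤ m) {T Y : ℝ} (hTY : T ≤ Y) :
    ‖∫ y in T..Y, 2 * (m : ℂ) ^ (-liRightPt y)‖ ≤ 4 * (m : ℝ) ^ (-(3 / 2 : ℝ)) / Real.log m := by
  have hm0 : 0 < m := by omega
  have hD : 0 < Real.log m := Real.log_pos (by exact_mod_cast (show 1 < m by omega))
  set M : ℝ := 2 * (m : ℝ) ^ (-(3 / 2 : ℝ)) with hM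
  have hM0 : 0 ≤ M := by positivity
  have key := norm_integral_le_of_logDeriv_integral (E := fun y ↦ 2 * (m : ℂ) ^ (-liRightPt y))
    (θ := fun _ ↦ -(Real.log m * I)) (θ' := fun _ ↦ 0) (B := fun _ ↦ 0) (D := Real.log m) (M := M)
    hTY hD hM0
    (fun y _ ↦ by
      have := (hasDerivAt_cpow_neg_rightPt hm0 y).const_mul (2 : ℂ)
      refine this.congr_deriv ?_
      ring)
    (fun y _ ↦ hasDerivAt_const y _)
    continuousOn_const continuousOn_const
    (fun y _ ↦ by
      rw [norm_neg, norm_mul, Complex.norm_real, Complex.norm_I, mul_one, Real.norm_of_nonneg hD.le])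
    (fun y _ ↦ by
      rw [norm_mul, norm_cpow_neg_rightPt hm0, hM]
      norm_num)
    (fun y _ ↦ by simp)
  simp only [intervalIntegral.integral_zero, mul_zero, add_zero] at key
  calc ‖∫ y in T..Y, 2 * (m : ℂ) ^ (-liRightPt y)‖ ≤ 2 * M / Real.log m := key
    _ = 4 * (m : ℝ) ^ (-(3 / 2 : ℝ)) / Real.log m := by rw [hM]; ring

/-- The `zⁿ` piece: `‖∫_T^Y m^{−w} zⁿ dy‖ ≤ m^{−3/2} (2/log m + 3n/(2T² log² m))` (`m ≥ 2`, `1 ≤ T ≤ Y`;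
phase derivative `≤ −log m`). -/
theorem norm_integral_plus_le {n m : ℕ} (hm : 2 ≤ m) {T Y : ℝ} (hT : 1 ≤ T) (hTY : T ≤ Y) :
    ‖∫ y in T..Y, (m : ℂ) ^ (-liRightPt y) * zq y ^ n‖ ≤
      (m : ℝ) ^ (-(3 / 2 : ℝ)) * (2 / Real.log m + 3 * n / (2 * T ^ 2 * Real.log m ^ 2)) := by
  have hm0 : 0 < m := by omega
  have hD : 0 < Real.log m := Real.log_pos (by exact_mod_cast (show 1 < m by omega))
  have hT0 : 0 < T := by linarith
  set M : ℝ := (m : ℝ) ^ (-(3 / 2 : ℝ)) with hM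
  have hM0 : 0 ≤ M := by positivity
  have key := norm_integral_le_of_logDeriv_integral (E := fun y ↦ (m : ℂ) ^ (-liRightPt y) * zq y ^ n)
    (θ := fun y ↦ -(Real.log m * I) + n * ld y) (θ' := fun y ↦ n * ld' y) (B := fun y ↦ 3 * (n : ℝ) / y ^ 3)
    (D := Real.log m) (M := M) hTY hD hM0
    (fun y _ ↦ by
      have := (hasDerivAt_cpow_neg_rightPt hm0 y).mul (hasDerivAt_zq_pow n y)
      refine this.congr_deriv ?_
      ring)
    (fun y _ ↦ ((hasDerivAt_ld y).const_mul (n : ℂ)).const_add _)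
    ((continuous_const.mul continuous_ld').continuousOn)
    (by
      refine ContinuousOn.div continuousOn_const (continuousOn_id.pow 3) fun y hy ↦ ?_
      exact pow_ne_zero _ (by linarith [hy.1] : y ≠ 0))
    (fun y hy ↦ by
      have hy1 : 1 ≤ y := hT.trans hy.1
      refine le_trans ?_ (Complex.abs_im_le_norm _)
      have him : ((-(Real.log m * I) + n * ld y : ℂ)).im = -Real.log m + n * (ld y).im := by
        simp only [Complex.add_im, Complex.neg_im, Complex.mul_im, Complex.ofReal_re, Complex.ofReal_im,
          Complex.I_re, Complex.I_im, Complex.natCast_re, Complex.natCast_im, mul_zero, mul_one, zero_mul,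
          add_zero]
      rw [him]
      have := (ld_im_bounds hy1).1
      have : (n : ℝ) * (ld y).im ≤ 0 := mul_nonpos_of_nonneg_of_nonpos (Nat.cast_nonneg n) this
      rw [abs_of_nonpos (by linarith)]
      linarith)
    (fun y _ ↦ by
      rw [norm_mul, norm_cpow_neg_rightPt hm0]
      exact mul_le_of_le_one_right hM0 (norm_zq_pow_le_one n y))
    (fun y hy ↦ by
      have hy1 : 1 ≤ y := hT.trans hy.1
      rw [norm_mul, Complex.norm_natCast]
      calc (n : ℝ) * ‖ld' y‖ ≤ n * (3 / y ^ 3) := by gcongr; exact norm_ld'_le hy1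
        _ = 3 * n / y ^ 3 := by ring)
  refine key.trans ?_
  have hI := integral_three_div_cube_le n hT0 hTY
  have hD2 : 0 ≤ M / Real.log m ^ 2 := by positivity
  calc 2 * M / Real.log m + M / Real.log m ^ 2 * ∫ y in T..Y, 3 * (n : ℝ) / y ^ 3
      ≤ 2 * M / Real.log m + M / Real.log m ^ 2 * (3 * n / (2 * T ^ 2)) := by gcongr
    _ = M * (2 / Real.log m + 3 * n / (2 * T ^ 2 * Real.log m ^ 2)) := by
        field_simp

/-- The `z⁻ⁿ` piece for a NON-RELEASED `m`: if `0 < g ≤ log m − n/T²` then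
`‖∫_T^Y m^{−w} z⁻ⁿ dy‖ ≤ m^{−3/2} e^{n/T²} (2/g + 3n/(2T² g²))` (`m ≥ 1`, `1 ≤ T ≤ Y`; phase derivative `≤ −g`). -/
theorem norm_integral_minus_le {n m : ℕ} (hm : 1 ≤ m) {T Y g : ℝ} (hT : 1 ≤ T) (hTY : T ≤ Y) (hg : 0 < g)
    (hgm : g ≤ Real.log m - n / T ^ 2) :
    ‖∫ y in T..Y, (m : ℂ) ^ (-liRightPt y) * (zq y ^ n)⁻¹‖ ≤
      (m : ℝ) ^ (-(3 / 2 : ℝ)) * Real.exp (n / T ^ 2) * (2 / g + 3 * n / (2 * T ^ 2 * g ^ 2)) := by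
  have hm0 : 0 < m := by omega
  have hT0 : 0 < T := by linarith
  set M : ℝ := (m : ℝ) ^ (-(3 / 2 : ℝ)) * Real.exp (n / T ^ 2) with hM
  have hM0 : 0 ≤ M := by positivity
  have key := norm_integral_le_of_logDeriv_integral (E := fun y ↦ (m : ℂ) ^ (-liRightPt y) * (zq y ^ n)⁻¹)
    (θ := fun y ↦ -(Real.log m * I) + -(n * ld y)) (θ' := fun y ↦ -(n * ld' y))
    (B := fun y ↦ 3 * (n : ℝ) / y ^ 3) (D := g) (M := M) hTY hg hM0
    (fun y _ ↦ by
      have := (hasDerivAt_cpow_neg_rightPt hm0 y).mul (hasDerivAt_zq_pow_inv n y)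
      refine this.congr_deriv ?_
      ring)
    (fun y _ ↦ ((hasDerivAt_ld y).const_mul (n : ℂ)).neg.const_add _)
    ((continuous_const.mul continuous_ld').neg.continuousOn)
    (by
      refine ContinuousOn.div continuousOn_const (continuousOn_id.pow 3) fun y hy ↦ ?_
      exact pow_ne_zero _ (by linarith [hy.1] : y ≠ 0))
    (fun y hy ↦ by
      have hy1 : 1 ≤ y := hT.trans hy.1
      have hy0 : 0 < y := by linarith
      refine le_trans ?_ (Complex.abs_im_le_norm _)
      have him : ((-(Real.log m * I) + -(n * ld y) : ℂ)).im = -Real.log m + n * (-(ld y).im) := by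
        simp only [Complex.add_im, Complex.neg_im, Complex.mul_im, Complex.ofReal_re, Complex.ofReal_im,
          Complex.I_re, Complex.I_im, Complex.natCast_re, Complex.natCast_im, mul_zero, mul_one, zero_mul,
          add_zero, mul_neg]
      rw [him]
      obtain ⟨hi1, hi2⟩ := ld_im_bounds hy1
      have hny : (n : ℝ) * (-(ld y).im) ≤ n / T ^ 2 := by
        calc (n : ℝ) * (-(ld y).im) ≤ n * (1 / y ^ 2) := mul_le_mul_of_nonneg_left hi2 (Nat.cast_nonneg n)
          _ ≤ n * (1 / T ^ 2) := by gcongr; exact hy.1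
          _ = n / T ^ 2 := by ring
      rw [abs_of_nonpos (by linarith)]
      linarith)
    (fun y hy ↦ by
      have hy0 : y ≠ 0 := by linarith [hT.trans hy.1]
      rw [norm_mul, norm_cpow_neg_rightPt hm0, hM]
      refine mul_le_mul_of_nonneg_left ((norm_zq_pow_inv_le_exp n hy0).trans ?_) (by positivity)
      refine Real.exp_le_exp.2 ?_
      gcongr; exact hy.1)
    (fun y hy ↦ by
      have hy1 : 1 ≤ y := hT.trans hy.1
      rw [norm_neg, norm_mul, Complex.norm_natCast]
      calc (n : ℝ) * ‖ld' y‖ ≤ n * (3 / y ^ 3) := by gcongr; exact norm_ld'_le hy1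
        _ = 3 * n / y ^ 3 := by ring)
  refine key.trans ?_
  have hI := integral_three_div_cube_le n hT0 hTY
  have hD2 : 0 ≤ M / g ^ 2 := by positivity
  calc 2 * M / g + M / g ^ 2 * ∫ y in T..Y, 3 * (n : ℝ) / y ^ 3
      ≤ 2 * M / g + M / g ^ 2 * (3 * n / (2 * T ^ 2)) := by gcongr
    _ = M * (2 / g + 3 * n / (2 * T ^ 2 * g ^ 2)) := by
        field_simp

/-! ### The whole non-released term -/

/-- The `m`-term integrand of the prime tail: `m^{−w} (2 − k_n(w))` on `w = 3/2 + iy`. -/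
def termIntegrand (n m : ℕ) (y : ℝ) : ℂ := (m : ℂ) ^ (-liRightPt y) * liCoSymWeight n (liRightPt y)

/-- `termIntegrand` is continuous in `y` (`m ≥ 1`). -/
theorem continuous_termIntegrand (n : ℕ) {m : ℕ} (hm : 0 < m) : Continuous (termIntegrand n m) :=
  (continuous_cpow_neg_rightPt hm).mul (continuous_coSymWeight n)

/-- `‖m^{−w}(2 − k_n(w))‖ ≤ m^{−3/2} e n² y^{−3/2}` for `y ≥ max(1, √n)`. -/
theorem norm_termIntegrand_le (n : ℕ) {m : ℕ} (hm : 0 < m) {y : ℝ} (hy1 : 1 ≤ y) (hyn : Real.sqrt n ≤ y) :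
    ‖termIntegrand n m y‖ ≤ (m : ℝ) ^ (-(3 / 2 : ℝ)) * (Real.exp 1 * (n : ℝ) ^ 2) * y ^ (-(3 / 2 : ℝ)) := by
  have hy0 : 0 < y := by linarith
  rw [termIntegrand, norm_mul, norm_cpow_neg_rightPt hm, mul_assoc]
  refine mul_le_mul_of_nonneg_left ((norm_coSymWeight_le n hyn hy0).trans ?_) (by positivity)
  have hr2 : 1 / y ^ 2 ≤ y ^ (-(3 / 2 : ℝ)) := by
    rw [Real.rpow_neg hy0.le, one_div]
    apply inv_anti₀ (by positivity)
    calc y ^ (3 / 2 : ℝ) ≤ y ^ (2 : ℝ) := Real.rpow_le_rpow_of_exponent_le hy1 (by norm_num)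
      _ = y ^ 2 := by rw [← Real.rpow_natCast]; norm_num
  calc Real.exp 1 * (n : ℝ) ^ 2 / y ^ 2 = Real.exp 1 * (n : ℝ) ^ 2 * (1 / y ^ 2) := by ring
    _ ≤ Real.exp 1 * (n : ℝ) ^ 2 * y ^ (-(3 / 2 : ℝ)) := by gcongr

/-- `termIntegrand n m` is integrable on `Ioi T` (`T ≥ 1`, `m ≥ 1`). -/
theorem integrableOn_termIntegrand (n : ℕ) {m : ℕ} (hm : 0 < m) {T : ℝ} (hT : 1 ≤ T) :
    IntegrableOn (termIntegrand n m) (Ioi T) := by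
  have hT0 : 0 < T := by linarith
  refine integrableOn_Ioi_of_tail (continuous_termIntegrand n hm)
    (K := (m : ℝ) ^ (-(3 / 2 : ℝ)) * (Real.exp 1 * (n : ℝ) ^ 2)) hT0 (le_max_left T (Real.sqrt n)) fun y hy ↦ ?_
  exact norm_termIntegrand_le n hm (hT.trans ((le_max_left _ _).trans hy.le)) ((le_max_right _ _).trans hy.le)

/-- `m^{−w}(2 − k_n) = 2m^{−w} − m^{−w}zⁿ − m^{−w}z⁻ⁿ`. -/
theorem termIntegrand_eq (n m : ℕ) (y : ℝ) :
    termIntegrand n m y = 2 * (m : ℂ) ^ (-liRightPt y) - (m : ℂ) ^ (-liRightPt y) * zq y ^ n -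
      (m : ℂ) ^ (-liRightPt y) * (zq y ^ n)⁻¹ := by
  rw [termIntegrand, coSymWeight_rightPt]
  have h0 : zq y ^ n ≠ 0 := pow_ne_zero _ (zq_ne_zero y)
  field_simp
  ring

/-- **Non-released terms, finite range**: for `m ≥ 2`, `1 ≤ T ≤ Y`, `0 < g ≤ log m − n/T²`,
`‖∫_T^Y m^{−w}(2 − k_n(w)) dy‖ ≤ m^{−3/2} (6/log m + 3n/(2T² log² m) + e^{n/T²}(2/g + 3n/(2T² g²)))`. -/
theorem norm_integral_termIntegrand_le {n m : ℕ} (hm : 2 ≤ m) {T Y g : ℝ} (hT : 1 ≤ T) (hTY : T ≤ Y)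
    (hg : 0 < g) (hgm : g ≤ Real.log m - n / T ^ 2) :
    ‖∫ y in T..Y, termIntegrand n m y‖ ≤ (m : ℝ) ^ (-(3 / 2 : ℝ)) *
      (6 / Real.log m + 3 * n / (2 * T ^ 2 * Real.log m ^ 2) +
        Real.exp (n / T ^ 2) * (2 / g + 3 * n / (2 * T ^ 2 * g ^ 2))) := by
  have hm0 : 0 < m := by omega
  have hc1 : Continuous fun y ↦ 2 * (m : ℂ) ^ (-liRightPt y) := continuous_const.mul (continuous_cpow_neg_rightPt hm0)
  have hc2 : Continuous fun y ↦ (m : ℂ) ^ (-liRightPt y) * zq y ^ n :=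
    (continuous_cpow_neg_rightPt hm0).mul (continuous_zq.pow n)
  have hc3 : Continuous fun y ↦ (m : ℂ) ^ (-liRightPt y) * (zq y ^ n)⁻¹ :=
    (continuous_cpow_neg_rightPt hm0).mul (continuous_zq_pow_inv n)
  have hsplit : ∫ y in T..Y, termIntegrand n m y = (∫ y in T..Y, 2 * (m : ℂ) ^ (-liRightPt y)) -
      (∫ y in T..Y, (m : ℂ) ^ (-liRightPt y) * zq y ^ n) - ∫ y in T..Y, (m : ℂ) ^ (-liRightPt y) * (zq y ^ n)⁻¹ := by
    simp_rw [termIntegrand_eq]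
    have i12 : IntervalIntegrable (fun y ↦ 2 * (m : ℂ) ^ (-liRightPt y) - (m : ℂ) ^ (-liRightPt y) * zq y ^ n)
        volume T Y := (hc1.sub hc2).intervalIntegrable _ _
    have i1 : IntervalIntegrable (fun y ↦ 2 * (m : ℂ) ^ (-liRightPt y)) volume T Y := hc1.intervalIntegrable _ _
    have i2 : IntervalIntegrable (fun y ↦ (m : ℂ) ^ (-liRightPt y) * zq y ^ n) volume T Y :=
      hc2.intervalIntegrable _ _
    have i3 : IntervalIntegrable (fun y ↦ (m : ℂ) ^ (-liRightPt y) * (zq y ^ n)⁻¹) volume T Y :=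
      hc3.intervalIntegrable _ _
    rw [intervalIntegral.integral_sub i12 i3, intervalIntegral.integral_sub i1 i2]
  rw [hsplit]
  have h1 := norm_integral_two_le hm hTY
  have h2 := norm_integral_plus_le (n := n) hm hT hTY
  have h3 := norm_integral_minus_le (n := n) (show 1 ≤ m by omega) hT hTY hg hgm
  calc ‖(∫ y in T..Y, 2 * (m : ℂ) ^ (-liRightPt y)) - (∫ y in T..Y, (m : ℂ) ^ (-liRightPt y) * zq y ^ n) -
        ∫ y in T..Y, (m : ℂ) ^ (-liRightPt y) * (zq y ^ n)⁻¹‖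
      ≤ ‖∫ y in T..Y, 2 * (m : ℂ) ^ (-liRightPt y)‖ + ‖∫ y in T..Y, (m : ℂ) ^ (-liRightPt y) * zq y ^ n‖ +
        ‖∫ y in T..Y, (m : ℂ) ^ (-liRightPt y) * (zq y ^ n)⁻¹‖ :=
          (norm_sub_le _ _).trans (add_le_add (norm_sub_le _ _) le_rfl)
    _ ≤ 4 * (m : ℝ) ^ (-(3 / 2 : ℝ)) / Real.log m +
        (m : ℝ) ^ (-(3 / 2 : ℝ)) * (2 / Real.log m + 3 * n / (2 * T ^ 2 * Real.log m ^ 2)) +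
        (m : ℝ) ^ (-(3 / 2 : ℝ)) * Real.exp (n / T ^ 2) * (2 / g + 3 * n / (2 * T ^ 2 * g ^ 2)) :=
          add_le_add (add_le_add h1 h2) h3
    _ = _ := by ring

/-- **Non-released terms, the tail integral**: the same bound for `∫_{Ioi T}` (`Y → ∞`). -/
theorem norm_setIntegral_termIntegrand_le {n m : ℕ} (hm : 2 ≤ m) {T g : ℝ} (hT : 1 ≤ T)
    (hg : 0 < g) (hgm : g ≤ Real.log m - n / T ^ 2) :
    ‖∫ y in Ioi T, termIntegrand n m y‖ ≤ (m : ℝ) ^ (-(3 / 2 : ℝ)) *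
      (6 / Real.log m + 3 * n / (2 * T ^ 2 * Real.log m ^ 2) +
        Real.exp (n / T ^ 2) * (2 / g + 3 * n / (2 * T ^ 2 * g ^ 2))) := by
  have hm0 : 0 < m := by omega
  have hlim := (intervalIntegral_tendsto_integral_Ioi T (integrableOn_termIntegrand n hm0 hT) tendsto_id).norm
  refine le_of_tendsto hlim ?_
  filter_upwards [eventually_ge_atTop T] with Y hY
  exact norm_integral_termIntegrand_le hm hT hY hg hgm

end PrimeTail

end Summit.RiemannHypothesis.RiemannHypothesis.Theorems.LiTheory

end
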